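import Literature.AlgebraicGeometry.Resolution.ImmediateRationalUniformization
import Literature.AlgebraicGeometry.Resolution.KnafKuhlmann2009Lemma216
import HarnessLib

/-!
# Eventual behaviour of values along the approach `c ↗ z` to an immediate element (Kuhlmann–Vlahu 2014, §§5–7, transcendental case)

Topic: `Literature/AlgebraicGeometry/Resolution` (valued function fields). PROVED generic
valuation theory for the normal forms of F.-V. Kuhlmann, *Elimination of ramification II*,
Israel J. Math. 234 (2019) = arXiv:1701.05508, §4.1 (Lemmas 4.2, 4.3: "since the approximation
type of `x` over `K` is transcendental, we may choose `α₀ ∈ v(x − K)` such that for all `c ∈ K`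
with `v(x − c) ≥ α₀` the values of `f_i(c)` are fixed, for every `i`. As the set `v(x − K)` has
no greatest element, we may choose `α₀` so large that for all `c` with `v(x − c) ≥ α₀` the
values of all monomials `f_i(c)(x − c)^i` will be distinct and there is `i₀ ≥ 1` such that
`vf_{i₀}(c)(x − c)^{i₀} < vf_i(c)(x − c)^i` for all `i ≥ 1`, `i ≠ i₀` (cf. [23, Lemma 5.1 and
Lemma 5.2]) … This can only be if `vf(x) = vf(c)`"), i.e. the part of F.-V. Kuhlmann, I. Vlahu,
*The relative approximation degree in valued function fields*, Math. Z. 276 (2014) =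
arXiv:1304.0200, §§5–7 (Lemmas 5.1–5.2, Lemma 6.? "(C4+)", Cor. 7.1) that concerns an element
of TRANSCENDENTAL approximation type, rendered without the language of approximation types:
"`P(c)` holds for `c ↗ z`" is `∃ a₀ ∈ K, ∀ a ∈ K, v(z − a) ≥ v(z − a₀) → P(a)` (multiplicative
values: `V.valuation (z - a) ≤ V.valuation (z - a₀)`), the standing hypotheses are those of
`ImmediateRationalUniformization.lean` (`hval`, `hres`: `(K(z)|K, v)` immediate; `h3`: every
polynomial over `K` has eventually constant value — condition (3) of Knaf–Kuhlmann 2009,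
Lemma 2.17).

## Content (everything PROVED; no definition, no named fact)

* `approach_eventually_and`, `approach_eventually_finset` — finitely many eventual properties hold eventually
  together (the balls around `z` are nested).
* `approach_lt_or_gt_or_zero` — for constants `α, β` and exponents `i < j` the comparison of
  `α v(z−a)^i` with `β v(z−a)^j` is eventually strict one way or the other (unless
  `α = β = 0`).
* `approach_exists_strict_winner` — among finitely many monomials `α_i v(z−a)ⁱ` (not all
  zero) one is eventually strictly the largest.
* `exists_eventually_dominant_taylor_term` — **[23, Lemma (C4+)]**: for a non-constant `f`
  over `K` there are an index `1 ≤ h ≤ deg f` and a threshold beyond which, for every centre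
  `a` and every `b ∈ K` with `v(b) = v(z − a)`, the Taylor term `f_h(a) b^h` strictly dominates
  all other `f_i(a) bⁱ`, `1 ≤ i ≤ deg f`, and `v(f_h(a))` is a fixed non-zero value.
* `valuation_sub_eval_eq_of_dominant` — hence `v(f(z) − f(a)) = v(f_h(a) b^h)` eventually
  ("(bhmin+)").
* `approach_valuation_sub_eval_lt`, `approach_valuation_eval_eq` — **[23, Cor. 7.1] /
  Kaplansky**: `v(f(z) − f(a)) < v(f(z))` and `v(f(a)) = v(f(z))` eventually.
* `taylor_coeff_hasseDeriv_one`, `approach_linear_term_dominant` — **[23, Prop. 7.4] with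
  `t = 0` / [K19, (4.15)]**: for `c ↗ z` the linear Taylor term `f_1(a)(z − a)` beats every
  `f_j(a)(z − a)ʲ` with `j ≥ 2` a unit of `V` (index prime to the residue characteristic).

## Sources

* [KV14] F.-V. Kuhlmann, I. Vlahu, Math. Z. 276 (2014) = arXiv:1304.0200: §§5–7.
* [K19] F.-V. Kuhlmann, Israel J. Math. 234 (2019) = arXiv:1701.05508: §4.1. [Kuhlmann2019]
* [KK09] H. Knaf, F.-V. Kuhlmann, Adv. Math. 221 (2009): Lemmas 2.5, 2.17, 2.18. [KnafKuhlmann2009]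
-/

noncomputable section

open IsLocalRing Polynomial Finset

namespace Literature.AlgebraicGeometry.Resolution

universe u

variable {Ω : Type u} [Field Ω] (V : ValuationSubring Ω) (K : Subfield Ω)

/-! ### Combining eventual properties -/

/-- Two properties holding for `c ↗ z` hold simultaneously for `c ↗ z`. [folklore] -/
theorem approach_eventually_and {z : Ω} {P Q : Ω → Prop}
    (hP : ∃ a₀ ∈ K, ∀ a ∈ K, V.valuation (z - a) ≤ V.valuation (z - a₀) → P a)
    (hQ : ∃ a₀ ∈ K, ∀ a ∈ K, V.valuation (z - a) ≤ V.valuation (z - a₀) → Q a) :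
    ∃ a₀ ∈ K, ∀ a ∈ K, V.valuation (z - a) ≤ V.valuation (z - a₀) → P a ∧ Q a := by
  obtain ⟨a₁, ha₁, h₁⟩ := hP
  obtain ⟨a₂, ha₂, h₂⟩ := hQ
  rcases le_total (V.valuation (z - a₁)) (V.valuation (z - a₂)) with h | h
  · exact ⟨a₁, ha₁, fun a ha hle => ⟨h₁ a ha hle, h₂ a ha (hle.trans h)⟩⟩
  · exact ⟨a₂, ha₂, fun a ha hle => ⟨h₁ a ha (hle.trans h), h₂ a ha hle⟩⟩

/-- Finitely many properties holding for `c ↗ z` hold simultaneously for `c ↗ z` (given some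
element of `K` to start with). [folklore] -/
theorem approach_eventually_finset {ι : Type*} (s : Finset ι) {z : Ω} {P : ι → Ω → Prop} {a₀ : Ω}
    (ha₀ : a₀ ∈ K)
    (hP : ∀ i ∈ s, ∃ a₀ ∈ K, ∀ a ∈ K, V.valuation (z - a) ≤ V.valuation (z - a₀) → P i a) :
    ∃ a₁ ∈ K, ∀ a ∈ K, V.valuation (z - a) ≤ V.valuation (z - a₁) → ∀ i ∈ s, P i a := by
  classical
  induction s using Finset.induction_on with
  | empty => exact ⟨a₀, ha₀, fun a _ _ i hi => absurd hi (Finset.notMem_empty i)⟩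
  | insert j s hj ih =>
    obtain ⟨a₁, ha₁, h₁⟩ := ih fun i hi => hP i (mem_insert_of_mem hi)
    obtain ⟨a₂, ha₂, h₂⟩ := approach_eventually_and V K (hP j (mem_insert_self j s)) ⟨a₁, ha₁, h₁⟩
    refine ⟨a₂, ha₂, fun a ha hle i hi => ?_⟩
    rcases mem_insert.mp hi with rfl | hi
    · exact (h₂ a ha hle).1
    · exact (h₂ a ha hle).2 i hi

/-! ### Eventual comparison of two monomials in `v(z - a)` -/

/-- **Eventual comparison of `α γⁱ` and `β γʲ`, `γ = v(z − a)`, `i < j`.** If `(K(z)|K, v)` is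
immediate with `z ∉ K` (so that the values `v(z − a)` have no minimum), then for `c ↗ z` either
`α v(z−a)^i < β v(z−a)^j` throughout, or `β v(z−a)^j < α v(z−a)^i` throughout, or `α = β = 0`:
the first relation is inherited by farther centres, the second by closer ones. [folklore] -/
theorem approach_lt_or_gt_or_zero {z : Ω} (hzK : z ∉ K)
    (hval : ∀ w ∈ Subfield.closure ((K : Set Ω) ∪ {z}), w ≠ 0 → ∃ b ∈ K,
      V.valuation w = V.valuation b)
    (hres : ∀ w ∈ Subfield.closure ((K : Set Ω) ∪ {z}), w ∈ V → ∃ c ∈ K,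
      V.valuation (w - c) < 1)
    {a₀ : Ω} (ha₀ : a₀ ∈ K) (α β : V.ValueGroup) {i j : ℕ} (hij : i < j) :
    (∃ a₁ ∈ K, ∀ a ∈ K, V.valuation (z - a) ≤ V.valuation (z - a₁) →
        α * V.valuation (z - a) ^ i < β * V.valuation (z - a) ^ j) ∨
      (∃ a₁ ∈ K, ∀ a ∈ K, V.valuation (z - a) ≤ V.valuation (z - a₁) →
        β * V.valuation (z - a) ^ j < α * V.valuation (z - a) ^ i) ∨
      (α = 0 ∧ β = 0) := by
  have hγ0 : ∀ a ∈ K, 0 < V.valuation (z - a) := fun a ha =>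
    (Valuation.pos_iff _).mpr (sub_ne_zero.mpr fun h => hzK (h ▸ ha))
  by_cases hall : ∀ a ∈ K, α * V.valuation (z - a) ^ i < β * V.valuation (z - a) ^ j
  · exact Or.inl ⟨a₀, ha₀, fun a ha _ => hall a ha⟩
  push Not at hall
  obtain ⟨a₁, ha₁, hge⟩ := hall
  by_cases hα : α = 0
  · -- then `β γ₁^j ≤ 0`, so `β = 0`
    right; right
    refine ⟨hα, ?_⟩
    rw [hα, zero_mul] at hge
    have := le_antisymm hge zero_le
    rcases mul_eq_zero.mp this with h | h
    · exact h
    · exact absurd h (pow_ne_zero _ (hγ0 a₁ ha₁).ne')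
  -- `α ≠ 0`: strictly closer centres satisfy the strict reverse inequality
  right; left
  obtain ⟨a₂, ha₂, hlt₂⟩ := exists_valuation_sub_lt V K hzK hval hres ha₁
  refine ⟨a₂, ha₂, fun a ha hle => ?_⟩
  have hγ : V.valuation (z - a) < V.valuation (z - a₁) := lt_of_le_of_lt hle hlt₂
  set γ := V.valuation (z - a) with hγdef
  set γ₁ := V.valuation (z - a₁) with hγ₁def
  have hγpos : 0 < γ := hγ0 a ha
  have hγ₁pos : 0 < γ₁ := hγ0 a₁ ha₁
  obtain ⟨k, hk⟩ : ∃ k, j = i + k + 1 := ⟨j - i - 1, by omega⟩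
  -- `β γ^j = β γ₁^j (γ/γ₁)^j ≤ α γ₁^i (γ/γ₁)^j < α γ₁^i (γ/γ₁)^i = α γ^i`
  have hρ : γ / γ₁ < 1 := (div_lt_one₀ hγ₁pos).mpr hγ
  have hρpos : 0 < γ / γ₁ := div_pos hγpos hγ₁pos
  have hαpos : 0 < α := zero_lt_iff.mpr hα
  calc β * γ ^ j = β * γ₁ ^ j * (γ / γ₁) ^ j := by
        rw [mul_assoc, ← mul_pow, mul_div_cancel₀ _ hγ₁pos.ne']
    _ ≤ α * γ₁ ^ i * (γ / γ₁) ^ j := mul_le_mul' hge le_rfl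
    _ < α * γ₁ ^ i * (γ / γ₁) ^ i := by
        refine mul_lt_mul_of_pos_left ?_ (mul_pos hαpos (pow_pos hγ₁pos i))
        rw [hk, add_assoc, pow_add]
        calc (γ / γ₁) ^ i * (γ / γ₁) ^ (k + 1) < (γ / γ₁) ^ i * 1 :=
              mul_lt_mul_of_pos_left (pow_lt_one₀ hρpos.le hρ (Nat.succ_ne_zero k))
                (pow_pos hρpos i)
          _ = (γ / γ₁) ^ i := mul_one _
    _ = α * γ ^ i := by rw [mul_assoc, ← mul_pow, mul_div_cancel₀ _ hγ₁pos.ne']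

/-! ### The eventual strict winner among monomials `α_i v(z - a)^i` -/

/-- **Eventual strict winner.** Let `(K(z)|K, v)` be immediate with `z ∉ K`, `s` a finite set
of exponents and `α_i` values, not all zero on `s`. Then there is `h ∈ s` with `α_h ≠ 0` such
that for `c ↗ z` the monomial `α_h v(z−a)^h` is strictly larger than every other
`α_i v(z−a)^i`, `i ∈ s` (pairwise eventual comparison, `approach_lt_or_gt_or_zero`, and
induction on `s`). [folklore] -/
theorem approach_exists_strict_winner {z : Ω} (hzK : z ∉ K)
    (hval : ∀ w ∈ Subfield.closure ((K : Set Ω) ∪ {z}), w ≠ 0 → ∃ b ∈ K,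
      V.valuation w = V.valuation b)
    (hres : ∀ w ∈ Subfield.closure ((K : Set Ω) ∪ {z}), w ∈ V → ∃ c ∈ K,
      V.valuation (w - c) < 1)
    (α : ℕ → V.ValueGroup) (s : Finset ℕ) {i₁ : ℕ} (hi₁ : i₁ ∈ s) (hαi₁ : α i₁ ≠ 0)
    {a₀ : Ω} (ha₀ : a₀ ∈ K) :
    ∃ h ∈ s, α h ≠ 0 ∧ ∃ a₁ ∈ K, ∀ a ∈ K, V.valuation (z - a) ≤ V.valuation (z - a₁) →
      ∀ i ∈ s, i ≠ h → α i * V.valuation (z - a) ^ i < α h * V.valuation (z - a) ^ h := by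
  classical
  have hγ0 : ∀ a ∈ K, 0 < V.valuation (z - a) := fun a ha =>
    (Valuation.pos_iff _).mpr (sub_ne_zero.mpr fun h => hzK (h ▸ ha))
  have key : ∀ s : Finset ℕ, ∃ h ∈ insert i₁ s, α h ≠ 0 ∧ ∃ a₁ ∈ K, ∀ a ∈ K,
      V.valuation (z - a) ≤ V.valuation (z - a₁) → ∀ i ∈ insert i₁ s, i ≠ h →
        α i * V.valuation (z - a) ^ i < α h * V.valuation (z - a) ^ h := by
    intro s
    induction s using Finset.induction_on with
    | empty =>
      exact ⟨i₁, mem_insert_self i₁ ∅, hαi₁, a₀, ha₀, fun a _ _ i hi hne =>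
        absurd (mem_singleton.mp (by simpa using hi)) hne⟩
    | insert j s hj ih =>
      obtain ⟨h, hh, hαh, a₁, ha₁, hwin⟩ := ih
      -- compare the terms of `j` and `h`
      by_cases hjh : j = h
      · refine ⟨h, ?_, hαh, a₁, ha₁, fun a ha hle i hi hne => ?_⟩
        · rw [Finset.insert_comm]; exact mem_insert_of_mem hh
        · rw [Finset.insert_comm, mem_insert] at hi
          rcases hi with rfl | hi
          · exact absurd hjh hne
          · exact hwin a ha hle i hi hne
      have hαhpos : ∀ a ∈ K, 0 < α h * V.valuation (z - a) ^ h := fun a ha =>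
        mul_pos (zero_lt_iff.mpr hαh) (pow_pos (hγ0 a ha) h)
      -- the eventual comparison of `α j γ^j` and `α h γ^h`
      have hcmp : (∃ a₂ ∈ K, ∀ a ∈ K, V.valuation (z - a) ≤ V.valuation (z - a₂) →
            α j * V.valuation (z - a) ^ j < α h * V.valuation (z - a) ^ h) ∨
          (∃ a₂ ∈ K, ∀ a ∈ K, V.valuation (z - a) ≤ V.valuation (z - a₂) →
            α h * V.valuation (z - a) ^ h < α j * V.valuation (z - a) ^ j) := by
        rcases lt_or_gt_of_ne hjh with hlt | hgt
        · rcases approach_lt_or_gt_or_zero V K hzK hval hres ha₁ (α j) (α h) hlt with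
            h1 | h1 | ⟨-, h0⟩
          · exact Or.inl h1
          · exact Or.inr h1
          · exact absurd h0 hαh
        · rcases approach_lt_or_gt_or_zero V K hzK hval hres ha₁ (α h) (α j) hgt with
            h1 | h1 | ⟨h0, -⟩
          · exact Or.inr h1
          · exact Or.inl h1
          · exact absurd h0 hαh
      rcases hcmp with ⟨a₂, ha₂, hjlt⟩ | ⟨a₂, ha₂, hhlt⟩
      · -- `h` still wins
        obtain ⟨a₃, ha₃, hboth⟩ := approach_eventually_and V K ⟨a₁, ha₁, hwin⟩ ⟨a₂, ha₂, hjlt⟩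
        refine ⟨h, ?_, hαh, a₃, ha₃, fun a ha hle i hi hne => ?_⟩
        · rw [Finset.insert_comm]; exact mem_insert_of_mem hh
        · rw [Finset.insert_comm, mem_insert] at hi
          rcases hi with rfl | hi
          · exact (hboth a ha hle).2
          · exact (hboth a ha hle).1 i hi hne
      · -- `j` wins
        obtain ⟨a₃, ha₃, hboth⟩ := approach_eventually_and V K ⟨a₁, ha₁, hwin⟩ ⟨a₂, ha₂, hhlt⟩
        have hαj : α j ≠ 0 := by
          intro h0
          have := (hboth a₃ ha₃ le_rfl).2
          rw [h0, zero_mul] at this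
          exact absurd this (not_lt.mpr (hαhpos a₃ ha₃).le)
        refine ⟨j, by rw [Finset.insert_comm]; exact mem_insert_self _ _, hαj, a₃, ha₃,
          fun a ha hle i hi hne => ?_⟩
        rw [Finset.insert_comm, mem_insert] at hi
        rcases hi with rfl | hi
        · exact absurd rfl hne
        · by_cases hih : i = h
          · rw [hih]; exact (hboth a ha hle).2
          · exact lt_trans ((hboth a ha hle).1 i hi hih) ((hboth a ha hle).2)
  obtain ⟨h, hh, hαh, a₁, ha₁, hwin⟩ := key (s.erase i₁)
  rw [insert_erase hi₁] at hh hwin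
  exact ⟨h, hh, hαh, a₁, ha₁, hwin⟩

/-! ### The eventually dominant Taylor term ([23, Lemma (C4+)], transcendental case) -/

/-- **The eventually dominant Taylor term.** Let `(K(z)|K, v)` be immediate with `z ∉ K` of
transcendental approximation type (`h3`), and `f` a non-constant polynomial over `K`. Then there
are an index `1 ≤ h ≤ deg f`, non-zero values `α_i` and a threshold beyond which: the Taylor
coefficients `f_i(a)`, `1 ≤ i ≤ deg f`, have the fixed values `α_i`, and the term `f_h(a)(z−a)^h`
strictly dominates every other `f_i(a)(z−a)ⁱ`, `1 ≤ i ≤ deg f`. [folklore] -/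
theorem exists_eventually_dominant_taylor_term {z : Ω} (hzK : z ∉ K)
    (hval : ∀ w ∈ Subfield.closure ((K : Set Ω) ∪ {z}), w ≠ 0 → ∃ b ∈ K,
      V.valuation w = V.valuation b)
    (hres : ∀ w ∈ Subfield.closure ((K : Set Ω) ∪ {z}), w ∈ V → ∃ c ∈ K,
      V.valuation (w - c) < 1)
    (h3 : ∀ g : Polynomial Ω, (∀ k, g.coeff k ∈ K) → ∃ a₀ ∈ K, ∃ α : V.ValueGroup,
      ∀ a ∈ K, V.valuation (z - a) ≤ V.valuation (z - a₀) → V.valuation (g.eval a) = α)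
    {f : Polynomial Ω} (hf : ∀ k, f.coeff k ∈ K) (hN : 0 < f.natDegree) :
    ∃ (α : ℕ → V.ValueGroup) (h : ℕ), 1 ≤ h ∧ h ≤ f.natDegree ∧ α h ≠ 0 ∧
      ∃ a₀ ∈ K, ∀ a ∈ K, V.valuation (z - a) ≤ V.valuation (z - a₀) →
        (∀ i, 1 ≤ i → i ≤ f.natDegree → V.valuation ((taylor a f).coeff i) = α i) ∧
        (∀ i, 1 ≤ i → i ≤ f.natDegree → i ≠ h →
          α i * V.valuation (z - a) ^ i < α h * V.valuation (z - a) ^ h) := by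
  classical
  set N := f.natDegree with hNdef
  -- some element of `K` (a first centre)
  obtain ⟨c₀, hc₀K, -⟩ := hres 0 (zero_mem _) V.zero_mem
  -- the eventual values `α i` of the Taylor coefficients `f_i(a) = (hasseDeriv i f)(a)`
  have hcoef : ∀ i, ∃ a₀ ∈ K, ∃ αi : V.ValueGroup, ∀ a ∈ K,
      V.valuation (z - a) ≤ V.valuation (z - a₀) → V.valuation ((taylor a f).coeff i) = αi := by
    intro i
    obtain ⟨a₀, ha₀, αi, h⟩ := h3 (hasseDeriv i f) (fun k => coeff_hasseDeriv_mem K hf i k)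
    exact ⟨a₀, ha₀, αi, fun a ha hle => by rw [taylor_coeff]; exact h a ha hle⟩
  choose a₀f ha₀f α hα using hcoef
  obtain ⟨T₀, hT₀K, hT₀⟩ := approach_eventually_finset V K (Icc 1 N) (P := fun i a =>
    V.valuation ((taylor a f).coeff i) = α i) hc₀K fun i _ => ⟨a₀f i, ha₀f i, hα i⟩
  -- `α N ≠ 0` (the leading coefficient)
  have hαN : α N ≠ 0 := by
    have h1 := hT₀ T₀ hT₀K le_rfl N (mem_Icc.mpr ⟨hN, le_rfl⟩)
    rw [← h1, show (taylor T₀ f).coeff N = (taylor T₀ f).leadingCoeff by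
      rw [leadingCoeff, natDegree_taylor], leadingCoeff_taylor]
    exact (_root_.map_ne_zero _).mpr (leadingCoeff_ne_zero.mpr fun h0 => by
      rw [h0, natDegree_zero] at hNdef; omega)
  -- positivity of `v(z - a)`
  have hγ0 : ∀ a ∈ K, 0 < V.valuation (z - a) := fun a ha =>
    (Valuation.pos_iff _).mpr (sub_ne_zero.mpr fun h => hzK (h ▸ ha))
  /- the winner -/
  obtain ⟨h, hh, hαh, a₁, ha₁, hwin⟩ := approach_exists_strict_winner V K hzK hval hres α (Icc 1 N)
    (mem_Icc.mpr ⟨hN, le_rfl⟩) hαN hc₀K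
  obtain ⟨a₄, ha₄, hall⟩ := approach_eventually_and V K ⟨T₀, hT₀K, hT₀⟩ ⟨a₁, ha₁, hwin⟩
  refine ⟨α, h, (mem_Icc.mp hh).1, (mem_Icc.mp hh).2, hαh, a₄, ha₄, fun a ha hle => ⟨?_, ?_⟩⟩
  · exact fun i hi hiN => (hall a ha hle).1 i (mem_Icc.mpr ⟨hi, hiN⟩)
  · exact fun i hi hiN hne => (hall a ha hle).2 i (mem_Icc.mpr ⟨hi, hiN⟩) hne

/-! ### `v(f(z) − f(a))` and `v(f(a))` for `c ↗ z` -/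

/-- Taylor expansion of `f(z) − f(a)` as a finite sum over `1 ≤ i ≤ deg f`. [folklore] -/
theorem eval_sub_eval_eq_sum_taylor (f : Polynomial Ω) (z a : Ω) :
    f.eval z - f.eval a = ∑ i ∈ Ico 1 (f.natDegree + 1), (taylor a f).coeff i * (z - a) ^ i := by
  have h1 : f.eval z = (taylor a f).eval (z - a) := by rw [taylor_eval, sub_add_cancel]
  rw [h1, eval_eq_sum_range' (by rw [natDegree_taylor]; exact Nat.lt_succ_self _), range_eq_Ico,
    sum_eq_sum_Ico_succ_bot (Nat.succ_pos _), taylor_coeff_zero, pow_zero, mul_one]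
  ring

/-- **"(bhmin+)"**: beyond the threshold of `exists_eventually_dominant_taylor_term`,
`v(f(z) − f(a)) = α_h v(z − a)^h`. [folklore] -/
theorem valuation_sub_eval_eq_of_dominant {z a : Ω} {f : Polynomial Ω} {α : ℕ → V.ValueGroup}
    {h : ℕ} (hh : 1 ≤ h) (hhN : h ≤ f.natDegree)
    (hcoef : ∀ i, 1 ≤ i → i ≤ f.natDegree → V.valuation ((taylor a f).coeff i) = α i)
    (hdom : ∀ i, 1 ≤ i → i ≤ f.natDegree → i ≠ h →
      α i * V.valuation (z - a) ^ i < α h * V.valuation (z - a) ^ h) (hαh : α h ≠ 0)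
    (hza : z - a ≠ 0) :
    V.valuation (f.eval z - f.eval a) = α h * V.valuation (z - a) ^ h := by
  classical
  rw [eval_sub_eval_eq_sum_taylor]
  have hmem : h ∈ Ico 1 (f.natDegree + 1) := mem_Ico.mpr ⟨hh, Nat.lt_succ_of_le hhN⟩
  rw [← Finset.add_sum_erase _ _ hmem]
  have hterm : V.valuation ((taylor a f).coeff h * (z - a) ^ h) = α h * V.valuation (z - a) ^ h := by
    rw [map_mul, map_pow, hcoef h hh hhN]
  have hpos : α h * V.valuation (z - a) ^ h ≠ 0 :=
    mul_ne_zero hαh (pow_ne_zero _ ((_root_.map_ne_zero _).mpr hza))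
  have hrest : V.valuation (∑ i ∈ (Ico 1 (f.natDegree + 1)).erase h,
      (taylor a f).coeff i * (z - a) ^ i) < α h * V.valuation (z - a) ^ h := by
    refine Valuation.map_sum_lt _ hpos fun i hi => ?_
    rw [mem_erase, mem_Ico] at hi
    rw [map_mul, map_pow, hcoef i hi.2.1 (by omega)]
    exact hdom i hi.2.1 (by omega) hi.1
  rw [← hterm] at hrest ⊢
  exact Valuation.map_add_eq_of_lt_left _ hrest

/-- **`v(f(z) − f(a)) < v(f(z))` for `c ↗ z`** ([23, Cor. 7.1], transcendental case): with
the hypotheses of `approach_valuation_eval_eq` below. Proof: for non-constant `f`,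
`v(f(z) − f(a)) = α_h v(z−a)^h` eventually, which takes pairwise distinct values at centres at
pairwise distinct distances; if it were `≥ v(f(z))` at three such centres, two of them would have
`v(f(a)) = v(f(z) − f(a))`, contradicting the constancy of `v(f(a))`. [folklore] -/
theorem approach_valuation_sub_eval_lt {z : Ω} (hzK : z ∉ K)
    (hval : ∀ w ∈ Subfield.closure ((K : Set Ω) ∪ {z}), w ≠ 0 → ∃ b ∈ K,
      V.valuation w = V.valuation b)
    (hres : ∀ w ∈ Subfield.closure ((K : Set Ω) ∪ {z}), w ∈ V → ∃ c ∈ K,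
      V.valuation (w - c) < 1)
    (h3 : ∀ g : Polynomial Ω, (∀ k, g.coeff k ∈ K) → ∃ a₀ ∈ K, ∃ α : V.ValueGroup,
      ∀ a ∈ K, V.valuation (z - a) ≤ V.valuation (z - a₀) → V.valuation (g.eval a) = α)
    {f : Polynomial Ω} (hf : ∀ k, f.coeff k ∈ K) (hfz : f.eval z ≠ 0) :
    ∃ a₀ ∈ K, ∀ a ∈ K, V.valuation (z - a) ≤ V.valuation (z - a₀) →
      V.valuation (f.eval z - f.eval a) < V.valuation (f.eval z) := by
  classical
  obtain ⟨c₀, hc₀K, -⟩ := hres 0 (zero_mem _) V.zero_mem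
  rcases Nat.eq_zero_or_pos f.natDegree with hN | hN
  · -- constant polynomial
    obtain ⟨f₀, hf₀⟩ := natDegree_eq_zero.mp hN
    refine ⟨c₀, hc₀K, fun a _ _ => ?_⟩
    rw [← hf₀, eval_C, eval_C, sub_self, map_zero]
    exact (Valuation.pos_iff _).mpr (by have := hfz; rwa [← hf₀, eval_C] at this)
  obtain ⟨α, h, hh, hhN, hαh, T₁, hT₁K, hT₁⟩ :=
    exists_eventually_dominant_taylor_term V K hzK hval hres h3 hf hN
  obtain ⟨T₂, hT₂K, αf, hT₂⟩ := h3 f hf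
  obtain ⟨T, hTK, hT⟩ := approach_eventually_and V K ⟨T₁, hT₁K, hT₁⟩ ⟨T₂, hT₂K, hT₂⟩
  have hza : ∀ a ∈ K, z - a ≠ 0 := fun a ha => sub_ne_zero.mpr fun h => hzK (h ▸ ha)
  set w := V.valuation (f.eval z) with hwdef
  have hw0 : w ≠ 0 := (_root_.map_ne_zero _).mpr hfz
  -- `φ(a) = v(f(z) - f(a)) = α h · v(z-a)^h` beyond `T`
  have hφ : ∀ a ∈ K, V.valuation (z - a) ≤ V.valuation (z - T) →
      V.valuation (f.eval z - f.eval a) = α h * V.valuation (z - a) ^ h := fun a ha hle =>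
    valuation_sub_eval_eq_of_dominant V hh hhN (hT a ha hle).1.1 (hT a ha hle).1.2 hαh (hza a ha)
  -- injectivity of `a ↦ φ(a)` in `v(z - a)`
  have hinj : ∀ a ∈ K, ∀ a' ∈ K, α h * V.valuation (z - a) ^ h = α h * V.valuation (z - a') ^ h →
      V.valuation (z - a) = V.valuation (z - a') := by
    intro a ha a' ha' heq
    have := mul_left_cancel₀ hαh heq
    exact le_antisymm (le_of_pow_le_pow_left₀ (by omega) zero_le this.le)
      (le_of_pow_le_pow_left₀ (by omega) zero_le this.ge)
  -- if `φ(a) > w` then `v(f(a)) = φ(a)`; so `φ(a) > w` happens for at most one distance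
  have hbig : ∀ a ∈ K, V.valuation (z - a) ≤ V.valuation (z - T) →
      w < V.valuation (f.eval z - f.eval a) → αf = α h * V.valuation (z - a) ^ h := by
    intro a ha hle hlt
    rw [← hφ a ha hle, ← (hT a ha hle).2]
    have : f.eval a = f.eval z - (f.eval z - f.eval a) := by ring
    conv_lhs => rw [this]
    exact Valuation.map_sub_eq_of_lt_right _ (by rw [hwdef] at hlt; exact hlt)
  -- eventually `φ(a) < w`
  have hev : ∃ a₀ ∈ K, ∀ a ∈ K, V.valuation (z - a) ≤ V.valuation (z - a₀) →
      V.valuation (f.eval z - f.eval a) < w := by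
    by_contra hnot
    push Not at hnot
    -- three centres beyond `T` at strictly decreasing distances with `φ ≥ w`
    have step : ∀ T' ∈ K, V.valuation (z - T') ≤ V.valuation (z - T) →
        ∃ a ∈ K, V.valuation (z - a) < V.valuation (z - T') ∧
          V.valuation (z - a) ≤ V.valuation (z - T) ∧ w ≤ V.valuation (f.eval z - f.eval a) := by
      intro T' hT'K hT'le
      obtain ⟨c, hcK, hclt⟩ := exists_valuation_sub_lt V K hzK hval hres hT'K
      obtain ⟨a, haK, hale, hwa⟩ := hnot c hcK
      exact ⟨a, haK, lt_of_le_of_lt hale hclt, (hale.trans hclt.le).trans hT'le, hwa⟩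
    obtain ⟨a₁, ha₁, h₁lt, h₁le, hw₁⟩ := step T hTK le_rfl
    obtain ⟨a₂, ha₂, h₂lt, h₂le, hw₂⟩ := step a₁ ha₁ h₁le
    obtain ⟨a₃, ha₃, h₃lt, h₃le, hw₃⟩ := step a₂ ha₂ h₂le
    -- among three values `≥ w` taking pairwise distinct values, two are `> w`
    have hφ₁ := hφ a₁ ha₁ h₁le
    have hφ₂ := hφ a₂ ha₂ h₂le
    have hφ₃ := hφ a₃ ha₃ h₃le
    have hne₁₂ : V.valuation (f.eval z - f.eval a₁) ≠ V.valuation (f.eval z - f.eval a₂) := by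
      rw [hφ₁, hφ₂]; exact fun heq => (hinj a₁ ha₁ a₂ ha₂ heq ▸ h₂lt).false
    have hne₂₃ : V.valuation (f.eval z - f.eval a₂) ≠ V.valuation (f.eval z - f.eval a₃) := by
      rw [hφ₂, hφ₃]; exact fun heq => (hinj a₂ ha₂ a₃ ha₃ heq ▸ h₃lt).false
    have hne₁₃ : V.valuation (f.eval z - f.eval a₁) ≠ V.valuation (f.eval z - f.eval a₃) := by
      rw [hφ₁, hφ₃]; exact fun heq => (hinj a₁ ha₁ a₃ ha₃ heq ▸ (h₃lt.trans h₂lt)).false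
    -- two centres with `φ > w` give `αf = φ`, contradicting distinctness
    have two : ∀ a ∈ K, ∀ a' ∈ K, V.valuation (z - a) ≤ V.valuation (z - T) →
        V.valuation (z - a') ≤ V.valuation (z - T) →
        w < V.valuation (f.eval z - f.eval a) → w < V.valuation (f.eval z - f.eval a') →
        V.valuation (f.eval z - f.eval a) = V.valuation (f.eval z - f.eval a') := by
      intro a ha a' ha' hle hle' hlt hlt'
      rw [hφ a ha hle, hφ a' ha' hle', ← hbig a ha hle hlt, ← hbig a' ha' hle' hlt']
    rcases hw₁.lt_or_eq with h1 | h1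
    · rcases hw₂.lt_or_eq with h2 | h2
      · exact hne₁₂ (two a₁ ha₁ a₂ ha₂ h₁le h₂le h1 h2)
      · rcases hw₃.lt_or_eq with h3' | h3'
        · exact hne₁₃ (two a₁ ha₁ a₃ ha₃ h₁le h₃le h1 h3')
        · exact hne₂₃ (h2.symm.trans h3')
    · rcases hw₂.lt_or_eq with h2 | h2
      · rcases hw₃.lt_or_eq with h3' | h3'
        · exact hne₂₃ (two a₂ ha₂ a₃ ha₃ h₂le h₃le h2 h3')
        · exact hne₁₃ (h1.symm.trans h3')
      · exact hne₁₂ (h1.symm.trans h2)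
  exact hev

/-- **Kaplansky / [23, Cor. 7.1]: the eventually constant value of `f(a)` is `v(f(z))`.** Let
`(K(z)|K, v)` be immediate with `z ∉ K` of transcendental approximation type, and `f` a
polynomial over `K` with `f(z) ≠ 0`. Then `v(f(a)) = v(f(z))` for `c ↗ z`. [folklore] -/
theorem approach_valuation_eval_eq {z : Ω} (hzK : z ∉ K)
    (hval : ∀ w ∈ Subfield.closure ((K : Set Ω) ∪ {z}), w ≠ 0 → ∃ b ∈ K,
      V.valuation w = V.valuation b)
    (hres : ∀ w ∈ Subfield.closure ((K : Set Ω) ∪ {z}), w ∈ V → ∃ c ∈ K,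
      V.valuation (w - c) < 1)
    (h3 : ∀ g : Polynomial Ω, (∀ k, g.coeff k ∈ K) → ∃ a₀ ∈ K, ∃ α : V.ValueGroup,
      ∀ a ∈ K, V.valuation (z - a) ≤ V.valuation (z - a₀) → V.valuation (g.eval a) = α)
    {f : Polynomial Ω} (hf : ∀ k, f.coeff k ∈ K) (hfz : f.eval z ≠ 0) :
    ∃ a₀ ∈ K, ∀ a ∈ K, V.valuation (z - a) ≤ V.valuation (z - a₀) →
      V.valuation (f.eval a) = V.valuation (f.eval z) := by
  obtain ⟨a₀, ha₀, hlt⟩ := approach_valuation_sub_eval_lt V K hzK hval hres h3 hf hfz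
  refine ⟨a₀, ha₀, fun a ha hle => ?_⟩
  have : f.eval a = f.eval z - (f.eval z - f.eval a) := by ring
  rw [this]
  exact Valuation.map_sub_eq_of_lt_left _ (hlt a ha hle)

/-! ### The linear term beats the terms of index prime to `p` ([23, Prop. 7.4] with `t = 0`) -/

/-- The `(i-1)`-st Taylor coefficient of `f' = hasseDeriv 1 f` is `i · f_i`. [folklore] -/
theorem taylor_coeff_hasseDeriv_one (f : Polynomial Ω) (a : Ω) {i : ℕ} (hi : 1 ≤ i) :
    (taylor a (hasseDeriv 1 f)).coeff (i - 1) = (i : Ω) * (taylor a f).coeff i := by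
  rw [taylor_coeff, taylor_coeff]
  have hcomp := congrArg (fun L : Polynomial Ω →ₗ[Ω] Polynomial Ω => L f) (hasseDeriv_comp (R := Ω) (i - 1) 1)
  simp only [LinearMap.comp_apply, LinearMap.smul_apply] at hcomp
  rw [hcomp, Nat.sub_add_cancel hi, eval_smul, nsmul_eq_mul, show i.choose (i - 1) = i from by
    rw [Nat.choose_symm hi, Nat.choose_one_right]]

/-- **The linear Taylor term eventually beats every term of unit index** ([23, Prop. 7.4] for
`i = p⁰ = 1`, `j` prime to `p`; cf. [K19, (4.15)]). Let `(K(z)|K, v)` be immediate with `z`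
transcendental over `K` of transcendental approximation type, and `f` a polynomial over `K` with
`f' ≠ 0`. Then for `c ↗ z`: `v(f_j(a)) v(z−a)^j < v(f_1(a)) v(z−a)` for every `j ≥ 2` which is
a unit of `V` (`v(j·1) = 1`). Proof: expand `f'(z) − f'(a) = ∑_{k≥1} (k+1) f_{k+1}(a)(z−a)^k`;
eventually each term is bounded by the value of the sum ((C4+) for `f'`), which is
`< v(f'(z)) = v(f'(a)) = v(f_1(a))` ([23, Cor. 7.1]). [folklore] -/
theorem approach_linear_term_dominant {z : Ω}
    (htrans : ∀ P : Polynomial Ω, (∀ k, P.coeff k ∈ K) → P.eval z = 0 → P = 0)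
    (hval : ∀ w ∈ Subfield.closure ((K : Set Ω) ∪ {z}), w ≠ 0 → ∃ b ∈ K,
      V.valuation w = V.valuation b)
    (hres : ∀ w ∈ Subfield.closure ((K : Set Ω) ∪ {z}), w ∈ V → ∃ c ∈ K,
      V.valuation (w - c) < 1)
    (h3 : ∀ g : Polynomial Ω, (∀ k, g.coeff k ∈ K) → ∃ a₀ ∈ K, ∃ α : V.ValueGroup,
      ∀ a ∈ K, V.valuation (z - a) ≤ V.valuation (z - a₀) → V.valuation (g.eval a) = α)
    {f : Polynomial Ω} (hf : ∀ k, f.coeff k ∈ K) (hf' : hasseDeriv 1 f ≠ 0) :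
    ∃ a₀ ∈ K, ∀ a ∈ K, V.valuation (z - a) ≤ V.valuation (z - a₀) →
      V.valuation ((taylor a f).coeff 1) ≠ 0 ∧
      ∀ j, 2 ≤ j → V.valuation ((j : ℕ) : Ω) = 1 →
        V.valuation ((taylor a f).coeff j) * V.valuation (z - a) ^ j <
          V.valuation ((taylor a f).coeff 1) * V.valuation (z - a) := by
  classical
  have hzK : z ∉ K := not_mem_of_forall_eval_eq_zero K htrans
  set g : Polynomial Ω := hasseDeriv 1 f with hgdef
  have hg : ∀ k, g.coeff k ∈ K := fun k => coeff_hasseDeriv_mem K hf 1 k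
  have hgz : g.eval z ≠ 0 := fun h0 => hf' (htrans g hg h0)
  have hγ0 : ∀ a ∈ K, 0 < V.valuation (z - a) := fun a ha =>
    (Valuation.pos_iff _).mpr (sub_ne_zero.mpr fun h => hzK (h ▸ ha))
  -- `f_1(a) = g(a)`
  have hf1 : ∀ a : Ω, (taylor a f).coeff 1 = g.eval a := fun a => by rw [taylor_coeff]
  -- eventual facts about `g`
  obtain ⟨T₁, hT₁K, hT₁⟩ := approach_valuation_sub_eval_lt V K hzK hval hres h3 hg hgz
  obtain ⟨T₂, hT₂K, hT₂⟩ := approach_valuation_eval_eq V K hzK hval hres h3 hg hgz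
  obtain ⟨T₁₂, hT₁₂K, hT₁₂⟩ := approach_eventually_and V K ⟨T₁, hT₁K, hT₁⟩ ⟨T₂, hT₂K, hT₂⟩
  rcases Nat.eq_zero_or_pos g.natDegree with hNg | hNg
  · -- `g` constant: `f_j = 0` for `j ≥ 2`
    refine ⟨T₁₂, hT₁₂K, fun a ha hle => ⟨?_, fun j hj _ => ?_⟩⟩
    · rw [hf1, (hT₁₂ a ha hle).2]; exact (_root_.map_ne_zero _).mpr hgz
    · have h0 : (taylor a f).coeff j = 0 := by
        have h1 : (taylor a g).coeff (j - 1) = 0 := by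
          rw [taylor_coeff, hasseDeriv_eq_zero_of_lt_natDegree g (j - 1) (by omega), eval_zero]
        rw [taylor_coeff_hasseDeriv_one f a (by omega : 1 ≤ j)] at h1
        rcases mul_eq_zero.mp h1 with h | h
        · exfalso
          have : V.valuation ((j : ℕ) : Ω) = 0 := by rw [h, map_zero]
          exact zero_ne_one (this.symm.trans ‹V.valuation ((j : ℕ) : Ω) = 1›)
        · exact h
      rw [h0, map_zero, zero_mul]
      have hpos : 0 < V.valuation ((taylor a f).coeff 1) := by
        rw [hf1, (hT₁₂ a ha hle).2]; exact (Valuation.pos_iff _).mpr hgz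
      exact mul_pos hpos (hγ0 a ha)
  -- `g` non-constant: (C4+) for `g`
  obtain ⟨α, h, hh, hhN, hαh, T₃, hT₃K, hT₃⟩ :=
    exists_eventually_dominant_taylor_term V K hzK hval hres h3 hg hNg
  obtain ⟨T, hTK, hT⟩ := approach_eventually_and V K ⟨T₁₂, hT₁₂K, hT₁₂⟩ ⟨T₃, hT₃K, hT₃⟩
  refine ⟨T, hTK, fun a ha hle => ?_⟩
  obtain ⟨⟨hlt, heq⟩, hcoefg, hdomg⟩ := hT a ha hle
  have hvg : V.valuation (g.eval a) = V.valuation (g.eval z) := heq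
  have hf1ne : V.valuation ((taylor a f).coeff 1) ≠ 0 := by
    rw [hf1, hvg]; exact (_root_.map_ne_zero _).mpr hgz
  refine ⟨hf1ne, fun j hj hunit => ?_⟩
  -- the value of the sum `g(z) - g(a)` and the bound on each term
  have hsum : V.valuation (g.eval z - g.eval a) = α h * V.valuation (z - a) ^ h :=
    valuation_sub_eval_eq_of_dominant V hh hhN hcoefg hdomg hαh (sub_ne_zero.mpr fun h0 => hzK (h0 ▸ ha))
  -- the term of index `j - 1` of `g` is `j f_j(a) (z-a)^{j-1}`
  have hterm : V.valuation ((taylor a g).coeff (j - 1)) * V.valuation (z - a) ^ (j - 1) ≤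
      α h * V.valuation (z - a) ^ h := by
    by_cases hjN : j - 1 ≤ g.natDegree
    · rw [hcoefg (j - 1) (by omega) hjN]
      by_cases hjh : j - 1 = h
      · rw [hjh]
      · exact (hdomg (j - 1) (by omega) hjN hjh).le
    · rw [taylor_coeff, hasseDeriv_eq_zero_of_lt_natDegree g (j - 1) (by omega), eval_zero,
        map_zero, zero_mul]
      exact zero_le
  rw [taylor_coeff_hasseDeriv_one f a (by omega : 1 ≤ j), map_mul, hunit, one_mul] at hterm
  -- `v(f_j(a)) γ^{j-1} ≤ v(g z - g a) < v(g z) = v(g a) = v(f_1(a))`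
  have hchain : V.valuation ((taylor a f).coeff j) * V.valuation (z - a) ^ (j - 1) <
      V.valuation ((taylor a f).coeff 1) := by
    calc V.valuation ((taylor a f).coeff j) * V.valuation (z - a) ^ (j - 1)
        ≤ α h * V.valuation (z - a) ^ h := hterm
      _ = V.valuation (g.eval z - g.eval a) := hsum.symm
      _ < V.valuation (g.eval z) := hlt
      _ = V.valuation ((taylor a f).coeff 1) := by rw [hf1, hvg]
  obtain ⟨k, hk⟩ : ∃ k, j = k + 1 := ⟨j - 1, by omega⟩
  rw [hk, Nat.add_sub_cancel] at hchain
  rw [hk, pow_succ, ← mul_assoc]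
  exact mul_lt_mul_of_pos_right hchain (hγ0 a ha)

end Literature.AlgebraicGeometry.Resolution

end
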